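import Summits.ValiantsHypothesis.ValiantsHypothesis.Theorems.KPlusLogSqLawTropicalShiftDiamondChain
import Summits.ValiantsHypothesis.ValiantsHypothesis.Theorems.KPlusLogSqLawTropicalBSumset

/-!
# Route «KPlusLogSqLaw» — DIAMOND, part 4: the diamond exponent type is an exactly solved sector of the tropical census

HONEST FRAMING.  Proof file (pure theorems) `--supports` the crux `Summit.ValiantsHypothesis.ValiantsHypothesis.Theses.KPlusLogSqLaw.TropicalB`
(ledger item `stmt-ValiantsHypothesis-19771`, route `KPlusLogSqLaw`; object-search cell `pub-symmetroid`, seat val-sym-trop-p5 g8, 2026-08-27).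
Nothing here asserts `TropicalB`, `WeakLifting`, `KPlusLogSqLaw`, `MatrixDescartes` (stmt-ValiantsHypothesis-18050) or anything about `VP ≠ VNP`,
and nothing bears on the `K = 4` fork: a quadratic-in-`m` sector, solved exactly.

CONTENTS.  The ceiling matching `diamond_le_of_tropRootLawAt` (part 3): if the exponents have the DIAMOND form `d l = d₀ + H(l)·G + j(l)·g`
with high digit `H(l) ≤ 2` and low digit `j(l) ≤ a` carried only on the middle level, the `m`-fold sumset consists of values
`m·d₀ + X·G + Y·g` with `X ≤ 2m`, `Y ≤ a·min(X, 2m − X)` — at most `Σ_{X ≤ 2m} (a·min(X, 2m−X) + 1) = a·m² + 2m + 1` slopes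
(`sum_min_eq_sq`, `card_slopeSet_le_of_diamondType`), so by val-sym-trop-p1's sumset law
(`KPlusLogSqLaw.Sumset.chain_succ_le_card_slopeSet`) every dominant sign-alternating chain has `n + 1 ≤ a·m² + 2m + 1` terms
(`chain_succ_le_of_diamondType`), whatever `G`, `g` and the format; with the DIAMOND design as the floor, **`diamond_row_iff (a m B)`**: among
`(m, a+3)` designs of diamond type, `B` bounds every chain iff `a·m² + 2m ≤ B`.  So, like the rank-two GAP rows (`gap_rankTwo_row_iff`), the
diamond rows are exactly solved for all `a`, `m`; a family beating `(K−3)m²` at `K` classes must use an exponent type outside both. -/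

set_option linter.dupNamespace false
set_option autoImplicit false

namespace Summit.ValiantsHypothesis.ValiantsHypothesis.Theorems.LacunarySymmetroidMatrixDescartes.TropicalCensus

open Summit.ValiantsHypothesis.ValiantsHypothesis.Theorems.MatrixDescartes.Negative
open Summit.ValiantsHypothesis.ValiantsHypothesis.Theorems.KPlusLogSqLaw.Sumset
open scoped BigOperators
open Finset

namespace ShiftDiamond

/-- `Σ_{X ≤ 2m} min(X, 2m − X) = m²` (two triangles). -/
theorem sum_min_eq_sq (m : ℕ) : ∑ X ∈ range (2 * m + 1), min X (2 * m - X) = m ^ 2 := by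
  have hsplit : 2 * m + 1 = (m + 1) + m := by ring
  rw [hsplit, sum_range_add]
  have h1 : ∑ X ∈ range (m + 1), min X (2 * m - X) = ∑ X ∈ range (m + 1), X := by
    refine sum_congr rfl fun X hX => ?_
    rw [mem_range] at hX
    exact min_eq_left (by omega)
  have h2 : ∑ X ∈ range m, min (m + 1 + X) (2 * m - (m + 1 + X)) = ∑ X ∈ range m, (m - 1 - X) := by
    refine sum_congr rfl fun X hX => ?_
    rw [mem_range] at hX
    rw [min_eq_right (by omega)]
    omega
  rw [h1, h2, sum_range_reflect (fun X => X) m, sum_range_succ]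
  have h3 := sum_range_id_mul_two m
  have h4 : m * (m - 1) + 2 * m = m ^ 2 + m := by
    rcases m with _ | k
    · simp
    · rw [Nat.add_sub_cancel]; ring
  nlinarith [h3, h4]

/-- **DIAMOND-type sumset ceiling.**  If the exponents have the form `d l = d₀ + H(l)·G + j(l)·g` with a high digit `H(l) ≤ 2` and a low
digit `j(l) ≤ a` carried ONLY on the middle level (`H(l) ≠ 1 → j(l) = 0`), then the achievable slopes are `m·d₀ + X·G + Y·g` with
`X ≤ 2m` and `Y ≤ a·min(X, 2m − X)`, so `#slopeSet m d ≤ a·m² + 2m + 1`. [folklore] -/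
theorem card_slopeSet_le_of_diamondType {K : ℕ} (m : ℕ) (d : Fin K → ℕ) (a d₀ G g : ℕ) (H j : Fin K → ℕ)
    (hH : ∀ l, H l ≤ 2) (hj : ∀ l, j l ≤ a) (hj0 : ∀ l, H l ≠ 1 → j l = 0)
    (hd : ∀ l, d l = d₀ + H l * G + j l * g) :
    (slopeSet m d).card ≤ a * m ^ 2 + 2 * m + 1 := by
  classical
  -- the DIAMOND box of digit sums `{(X, Y) : X ≤ 2m, Y ≤ a·min(X, 2m − X)}`, of size `Σ_X (a·min(X, 2m−X) + 1) = a·m² + 2m + 1`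
  set box : Finset (Σ _ : ℕ, ℕ) := (range (2 * m + 1)).sigma fun X => range (a * min X (2 * m - X) + 1) with hbox
  have hcard : box.card = a * m ^ 2 + 2 * m + 1 := by
    rw [hbox, card_sigma]
    simp only [card_range]
    rw [sum_add_distrib, sum_const, card_range, smul_eq_mul, mul_one, ← mul_sum, sum_min_eq_sq]
    ring
  rw [← hcard]
  -- every achievable slope is the value of `(X, Y) ↦ m d₀ + X G + Y g` at a point of the box
  have hsub : slopeSet m d ⊆ box.image fun XY => (m : ℤ) * d₀ + (XY.1 : ℤ) * G + (XY.2 : ℤ) * g := by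
    intro s hs
    obtain ⟨lam, rfl⟩ := mem_slopeSet.mp hs
    rw [mem_image]
    refine ⟨⟨∑ i, H (lam i), ∑ i, j (lam i)⟩, ?_, ?_⟩
    · simp only [hbox, mem_sigma, mem_range]
      have hX : ∑ i, H (lam i) ≤ 2 * m := by
        calc ∑ i, H (lam i) ≤ ∑ _i : Fin m, 2 := sum_le_sum fun i _ => hH _
          _ = 2 * m := by rw [sum_const, card_univ, Fintype.card_fin, smul_eq_mul, mul_comm]
      have hY1 : ∑ i, j (lam i) ≤ a * ∑ i, H (lam i) := by
        rw [mul_sum]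
        refine sum_le_sum fun i _ => ?_
        by_cases h1 : H (lam i) = 1
        · rw [h1, mul_one]; exact hj _
        · rw [hj0 _ h1]; exact Nat.zero_le _
      have hY2 : ∑ i, j (lam i) + a * ∑ i, H (lam i) ≤ 2 * a * m := by
        rw [mul_sum, ← sum_add_distrib]
        calc ∑ i, (j (lam i) + a * H (lam i)) ≤ ∑ _i : Fin m, 2 * a := sum_le_sum fun i _ => by
                by_cases h1 : H (lam i) = 1
                · rw [h1, mul_one]; have := hj (lam i); omega
                · rw [hj0 _ h1, zero_add]; exact Nat.mul_le_mul_left _ (hH _) |>.trans (by rw [mul_comm])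
          _ = 2 * a * m := by rw [sum_const, card_univ, Fintype.card_fin, smul_eq_mul]; ring
      refine ⟨by omega, ?_⟩
      have : ∑ i, j (lam i) ≤ a * min (∑ i, H (lam i)) (2 * m - ∑ i, H (lam i)) := by
        rcases le_total (∑ i, H (lam i)) (2 * m - ∑ i, H (lam i)) with hle | hle
        · rw [min_eq_left hle]; exact hY1
        · rw [min_eq_right hle]
          have e : a * (2 * m - ∑ i, H (lam i)) = 2 * a * m - a * ∑ i, H (lam i) := by
            rw [Nat.mul_sub, ← mul_assoc, mul_comm a 2]
          rw [e]; omega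
      omega
    · symm
      simp only [hd, Nat.cast_add, Nat.cast_mul, Nat.cast_sum]
      rw [sum_add_distrib, sum_add_distrib, sum_const, card_univ, Fintype.card_fin, nsmul_eq_mul, sum_mul, sum_mul]
  exact (card_le_card hsub).trans card_image_le

/-- **Chains under the DIAMOND type.**  Every sign-alternating dominant chain of a design whose exponents have the DIAMOND form
`d₀ + H·G + j·g` (`H ≤ 2`, `j ≤ a`, `j = 0` off the middle level) has `n + 1 ≤ a·m² + 2m + 1` terms, whatever `G, g`. [folklore] -/
theorem chain_succ_le_of_diamondType {m K : ℕ} (d : Fin K → ℕ) (v ε : Fin m → Fin m → Fin K → ℤ) {n : ℕ}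
    (θ : Fin (n + 1) → ℤ) (p : Fin (n + 1) → Equiv.Perm (Fin m) × (Fin m → Fin K))
    (hθ : StrictMono θ) (hdom : ∀ k, IsDominant d v ε (θ k) (p k))
    (halt : ∀ k : Fin n, termSign ε (p k.castSucc) * termSign ε (p k.succ) < 0)
    (a d₀ G g : ℕ) (H j : Fin K → ℕ) (hH : ∀ l, H l ≤ 2) (hj : ∀ l, j l ≤ a) (hj0 : ∀ l, H l ≠ 1 → j l = 0)
    (hd : ∀ l, d l = d₀ + H l * G + j l * g) :
    n + 1 ≤ a * m ^ 2 + 2 * m + 1 :=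
  (chain_succ_le_card_slopeSet d v ε θ p hθ hdom halt).trans (card_slopeSet_le_of_diamondType m d a d₀ G g H j hH hj hj0 hd)

set_option maxHeartbeats 400000 in
/-- **THE DIAMOND SECTOR IS EXACTLY `a·m² + 2m`.**  Among designs of format `(m, a+3)` whose exponents have the DIAMOND form
`d l = d₀ + H(l)·G + j(l)·g` — high digit `H(l) ≤ 2`, low digit `j(l) ≤ a` carried only on the middle level (`H(l) ≠ 1 → j(l) = 0`) — a
number `B` bounds the sign changes of every dominant sign-alternating chain iff `a·m² + 2m ≤ B`: the ceiling is the sumset count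
(`chain_succ_le_of_diamondType`), the floor is the DIAMOND design (`H = hi`, `j = lo`, `G = D`, `g = 1`). -/
theorem diamond_row_iff (a m B : ℕ) :
    (∀ (d : Fin (a + 3) → ℕ) (d₀ G g : ℕ) (H j : Fin (a + 3) → ℕ), (∀ l, H l ≤ 2) → (∀ l, j l ≤ a) → (∀ l, H l ≠ 1 → j l = 0) →
        (∀ l, d l = d₀ + H l * G + j l * g) →
        ∀ (v ε : Fin m → Fin m → Fin (a + 3) → ℤ) (N : ℕ) (θ : Fin (N + 1) → ℤ)
          (p : Fin (N + 1) → Equiv.Perm (Fin m) × (Fin m → Fin (a + 3))),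
          (∀ i j l, (ε i j l).natAbs ≤ 1) → StrictMono θ → (∀ k, IsDominant d v ε (θ k) (p k)) →
          (∀ k : Fin N, termSign ε (p k.castSucc) * termSign ε (p k.succ) < 0) → N ≤ B) ↔
      a * m ^ 2 + 2 * m ≤ B := by
  constructor
  · intro h
    rcases m with _ | n
    · simp
    · rw [← st_top a n]
      have hmain := h (dd a n) 0 (bigD a n) 1 (hi a) (lo a) (hi_le_two a) (lo_le a)
        (fun l hl => by unfold hi lo at *; split_ifs at * <;> simp_all)
        (fun l => by unfold dd; ring)
        (vv a n) (ee a n) (st a n (2 * (n + 1))) (fun k => th a n (grid a n k).1 (grid a n k).2)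
        (fun k => cterm a n (grid a n k).1 (grid a n k).2) (fun r b l => (ee_natAbs a n r b l).le) ?_ ?_ ?_
      · exact hmain
      · refine Fin.strictMono_iff_lt_succ.mpr fun k => ?_
        simp only [Fin.val_castSucc, Fin.val_succ]
        exact th_grid_lt a n k (by omega)
      · intro k
        obtain ⟨_, h2, h3⟩ := grid_inv a n k (by omega)
        exact isDominant_cterm a n _ _ h3 h2
      · intro k
        simp only [Fin.val_castSucc, Fin.val_succ]
        rw [termSign_grid a n k (by omega), termSign_grid a n (k + 1) (by omega), ← pow_add,
          show (k : ℕ) + (k + 1) = 2 * k + 1 by ring, pow_succ, pow_mul]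
        norm_num
  · intro hB d d₀ G g H j hH hj hj0 hd v ε N θ p _hε hθ hdom halt
    have h := chain_succ_le_of_diamondType d v ε θ p hθ hdom halt a d₀ G g H j hH hj hj0 hd
    omega

end ShiftDiamond

end Summit.ValiantsHypothesis.ValiantsHypothesis.Theorems.LacunarySymmetroidMatrixDescartes.TropicalCensus
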